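import Summits.KontsevichZagierPeriods.Zeta5Search.RVFlatGaugeCapLemmas
import HarnessLib

/-!
# RVFlatGaugeCapCore — the unit budget of the flat `S₇`-gauge below `b₀ < 3p` (fam-rv gen 8, file 2/4)

HONEST FRAMING: systematic search; no irrationality claim unless certified.  Pure arithmetic about the tree's
definitions; nothing minted by this cell is used as a hypothesis; no γ / measure claim.

THE BUDGET (`Cap.flatBudget`).  Let `c` lie in the Brown–Zudilin polytope, `p ≥ 5` prime, `c₀ + 2 < p²`, at most one
block `c₀ − 2c_k ≥ p` (the LONG slot `i`), and `c₀ < 3p`.  Then every pair form, every lower parameter and `d` have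
`p`-adic "digit" `⌊·/p⌋ ∈ {0,1}` (`d`: `≤ 2`), gen-1's closed scalar has
`v_p ρ(c) = Σ_E ⌊form/p⌋ − Σ_{j∈{1,4,5,6,7}} ⌊c_j/p⌋ − ⌊d/p⌋` (`Cap.padicValRat_rhoB_midParams`), and the comparison
"flat `S₇`-gauge `−e_D♭ − v_p ρ` versus the class-law quantity `refund − N_p`" is a count of UNITS:
* charged: `a ≤ 2` non-`E` pair floors (the non-`E` pairs form the path `2–7–1–6–4–5–3` of `K₇`, so at most two pass
  through the long slot), the denominator floors `Σ ⌊c_j/p⌋ ≤ nden ≤ nbig` (`nden` = large parameters sitting in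
  ρ's denominator slots `{1,4,5,6,7}`), and `⌊d/p⌋ − min(1,⌊d/p⌋) = [2p ≤ d]`;
* paying: `e_D♭ = T + L` with `T ≥ min(4, a + nbig)` (the charged objects are DISTINCT entries `≥ p` of the 28-form
  scheme, `Cap.le_T4_of_countP`) and `L ≥ 1` as soon as `a + nbig ≥ 5` (`p ≤ m₅`) or `2p ≤ d` (`p ≤ ⌊d/2⌋ ≤ m₅♭`);
* and under DISJOINTNESS (DISJ: no lower parameter `≥ p` is a partner in a pair form `≥ p`) the path structure
  gives `a + nden ≤ 5` (`Cap.path_budget`, a finite check by `decide`).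
`RVFlatGaugeCap.lean` closes this budget in the two regimes (CAP) `nbig + [2p ≤ d] ≤ 3` and (DISJ) `∧ d < 2p`.

CONTENTS: `Cap.denSlots`, `Cap.nden`, `Cap.disj_permLower` ((DISJ) is an `S₇`-invariant hypothesis),
`Cap.path_budget`, `Cap.b0_lt_three_p` (`nbig ≤ 5` and one long block force `c₀ < 3p`), `Cap.flatBudget`.
-/

namespace Summit.KontsevichZagierPeriods.Zeta5Search.RVFlatGauge

open Finset
open Summit.KontsevichZagierPeriods.Zeta5Search.CasoratianValuation (casoratian shift InPolytope pairFloors refund)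
open Summit.KontsevichZagierPeriods.Zeta5Search.WedgeDictionary (dOf Epairs)
open Summit.KontsevichZagierPeriods.Zeta5Search.SymmetricGauge
open Summit.KontsevichZagierPeriods.Zeta5Search.DualSeries (InBox)
open Window

namespace Cap

/-! ### Denominator slots, the disjointness hypothesis, the path budget -/

/-- ρ's denominator slots `{1,4,5,6,7}` in 0-based labels (`c (k+1)` with `k ∈ {0,3,4,5,6}`) — the INTERIOR vertices of
the non-`E` path `2–7–1–6–4–5–3`. -/
def denSlots : Finset ℕ := {0, 3, 4, 5, 6}

/-- The number of LARGE lower parameters (`≥ p`) sitting in ρ's denominator slots. -/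
def nden (c : ℕ → ℤ) (p : ℕ) : ℕ := (denSlots.filter fun k => (p : ℤ) ≤ c (k + 1)).card

/-- **(DISJ) is `S₇`-invariant.**  (DISJ) = "no large lower parameter is a partner in a large pair form": whenever
`c_k ≥ p`, every pair form `c₀ − c_j − c_k` (`j ≠ k`) is `< p` (stated inline; no new `Prop` is minted). -/
theorem disj_permLower (σ : Equiv.Perm (Fin 7)) {b : ℕ → ℤ} {p : ℕ}
    (h : ∀ j ∈ range 7, ∀ k ∈ range 7, j ≠ k → (p : ℤ) ≤ b (k + 1) → b 0 - b (j + 1) - b (k + 1) < p) :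
    ∀ j ∈ range 7, ∀ k ∈ range 7, j ≠ k → (p : ℤ) ≤ permLower σ b (k + 1) →
      permLower σ b 0 - permLower σ b (j + 1) - permLower σ b (k + 1) < p := by
  intro j hj k hk hjk hbig
  have hj7 := mem_range.1 hj
  have hk7 := mem_range.1 hk
  have ej := permLower_apply_succ σ b ⟨j, hj7⟩
  have ek := permLower_apply_succ σ b ⟨k, hk7⟩
  simp only at ej ek
  rw [permLower_zero, ej, ek]
  rw [ek] at hbig
  refine h _ (mem_range.2 (σ ⟨j, hj7⟩).isLt) _ (mem_range.2 (σ ⟨k, hk7⟩).isLt) ?_ hbig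
  intro heq
  exact hjk (by simpa using congrArg Fin.val (σ.injective (Fin.ext heq)))

set_option maxRecDepth 200000 in
/-- **The path budget** (finite check).  If `A` is a set of non-`E` pairs through one slot `i` and `K ⊆ {0,…,6}` avoids
both ends of every pair in `A`, then `|A| + |K ∩ denSlots| ≤ 5`: an interior vertex of the path `2–7–1–6–4–5–3` never
has both its neighbours at the two ends `2, 3`, and every non-`E` pair has an interior end. -/
theorem path_budget : ∀ i ∈ range 7, ∀ A ∈ (nonE.filter fun x : ℕ × ℕ => x.1 = i ∨ x.2 = i).powerset,
    ∀ K ∈ (range 7).powerset, (∀ x ∈ A, x.1 ∉ K ∧ x.2 ∉ K) → A.card + (denSlots.filter fun k => k ∈ K).card ≤ 5 := by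
  decide +kernel

/-- With at most one long block, `nbig ≤ 5` forces `c₀ < 3p` (else the six short slots carry parameters `≥ p`). -/
theorem b0_lt_three_p {c : ℕ → ℤ} {p : ℕ} {i : ℕ} (hshort : ∀ k ∈ (range 7).erase i, c 0 - 2 * c (k + 1) < p)
    (h5 : nbig c p ≤ 5) : c 0 < 3 * (p : ℤ) := by
  by_contra h3
  rw [not_lt] at h3
  obtain ⟨i, hi7, hblk⟩ : ∃ i', i' < 7 ∧ ∀ k, k < 7 → k ≠ i' → c 0 - 2 * c (k + 1) < (p : ℤ) := by
    by_cases hi : i < 7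
    · exact ⟨i, hi, fun k hk hki => hshort k (mem_erase.2 ⟨hki, mem_range.2 hk⟩)⟩
    · exact ⟨0, by norm_num, fun k hk _ => hshort k (mem_erase.2 ⟨by omega, mem_range.2 hk⟩)⟩
  have hsub : (univ : Finset (Fin 7)).erase ⟨i, hi7⟩ ⊆ univ.filter (fun k : Fin 7 => (p : ℤ) ≤ c (k.val + 1)) := by
    intro k hk
    rw [mem_filter]
    refine ⟨mem_univ _, ?_⟩
    have hki : k.val ≠ i := fun h => (mem_erase.1 hk).1 (Fin.ext h)
    have := hblk k.val k.isLt hki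
    omega
  have h6 := card_le_card hsub
  rw [card_erase_of_mem (mem_univ _), card_univ, Fintype.card_fin] at h6
  unfold nbig at h5
  omega

/-! ### The budget -/

/-- **The unit budget below `c₀ < 3p`** (see the module docstring): the charged units `a` (non-`E` pair floors),
`denSum ≤ nden ≤ nbig`, `[2p ≤ d]`, against the payers `e_D♭ = T + L`, together with the closed forms of `v_p ρ`,
`N_p = eSum + nonESum` and `refund`, and the path budget `a + nden ≤ 5` under (DISJ). -/
theorem flatBudget (c : ℕ → ℤ) {p : ℕ} (hc : InPolytope c) (hp : p.Prime) (hp5 : 5 ≤ p)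
    (hwin : (c 0 + 2 : ℤ) < (p : ℤ) ^ 2) {i : ℕ}
    (hshort : ∀ k ∈ (range 7).erase i, c 0 - 2 * c (k + 1) < p) (hc3 : c 0 < 3 * (p : ℤ)) :
    ∃ a T L : ℤ, 0 ≤ a ∧ a ≤ 2 ∧ nonESum c p ≤ a ∧ denSum c p ≤ nden c p ∧ (nden c p : ℤ) ≤ nbig c p ∧
      min 4 (a + nbig c p) ≤ T ∧ (5 ≤ a + (nbig c p : ℤ) → 1 ≤ L) ∧ (2 * (p : ℤ) ≤ dOf c → 1 ≤ L) ∧ 0 ≤ L ∧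
      eDflat c p = T + L ∧ padicValRat p (rhoB c) = eSum c p - denSum c p - dOf c / p ∧
      pairFloors c p = eSum c p + nonESum c p ∧ refund c p = min 1 (dOf c / (p : ℤ)) ∧
      0 ≤ dOf c / (p : ℤ) ∧ dOf c / (p : ℤ) ≤ 2 ∧
      ((∀ j ∈ range 7, ∀ k ∈ range 7, j ≠ k → (p : ℤ) ≤ c (k + 1) → c 0 - c (j + 1) - c (k + 1) < p) →
        a + (nden c p : ℤ) ≤ 5) := by
  have hp1 : 1 < p := hp.one_lt
  have hp0 : (0 : ℤ) < p := by exact_mod_cast hp.pos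
  have hp2 : p ≠ 2 := by omega
  obtain ⟨⟨h00, hbox⟩, hhalf, hsum⟩ := id hc
  have hnn : ∀ k, k < 7 → 0 ≤ c (k + 1) ∧ 2 * c (k + 1) ≤ c 0 := fun k hk =>
    ⟨(hbox k (mem_range.2 hk)).1, hhalf k (mem_range.2 hk)⟩
  -- normalise the long-block index into `range 7`
  obtain ⟨i, hi7, hblk⟩ : ∃ i', i' < 7 ∧ ∀ k, k < 7 → k ≠ i' → c 0 - 2 * c (k + 1) < (p : ℤ) := by
    by_cases hi : i < 7
    · exact ⟨i, hi, fun k hk hki => hshort k (mem_erase.2 ⟨hki, mem_range.2 hk⟩)⟩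
    · exact ⟨0, by norm_num, fun k hk _ => hshort k (mem_erase.2 ⟨by omega, mem_range.2 hk⟩)⟩
  -- `B` := the slots with a large lower parameter; `|B| = nbig`
  set B := univ.filter (fun k : Fin 7 => (p : ℤ) ≤ c (k.val + 1)) with hB
  have hBn : B.card = nbig c p := by rw [hB]; rfl
  -- `0 ≤ d < 3p ≤ p²`
  have hd0 : 0 ≤ dOf c := by unfold dOf; linarith
  have hd3 : dOf c < 3 * (p : ℤ) := by
    have h6 : ∑ k ∈ (range 7).erase i, (c 0 - 2 * c (k + 1)) ≤ 6 * ((p : ℤ) - 1) := by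
      have h := Finset.sum_le_card_nsmul ((range 7).erase i) (fun k => c 0 - 2 * c (k + 1)) ((p : ℤ) - 1)
        (fun k hk => by
          have hk' := mem_erase.1 hk
          have := hblk k (mem_range.1 hk'.2) hk'.1
          show c 0 - 2 * c (k + 1) ≤ (p : ℤ) - 1
          omega)
      rw [card_erase_of_mem (mem_range.2 hi7), card_range] at h
      simpa [nsmul_eq_mul] using h
    have hsplit := Finset.sum_erase_eq_sub (f := fun k => c 0 - 2 * c (k + 1)) (mem_range.2 hi7)
    have hall : ∑ k ∈ range 7, (c 0 - 2 * c (k + 1)) = 7 * c 0 - 2 * ∑ k ∈ range 7, c (k + 1) := by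
      rw [Finset.sum_sub_distrib, Finset.sum_const, card_range, ← Finset.mul_sum]
      simp
    have hci := (hnn i hi7).1
    rw [hsplit, hall] at h6
    unfold dOf
    linarith
  have hp3 : (3 : ℤ) ≤ p := by exact_mod_cast (by omega : 3 ≤ p)
  have hdp : dOf c < (p : ℤ) ^ 2 := by nlinarith
  have ht0 : 0 ≤ dOf c / (p : ℤ) := Int.ediv_nonneg hd0 hp0.le
  have ht2 : dOf c / (p : ℤ) ≤ 2 := by
    have := (Int.ediv_lt_iff_lt_mul hp0).2 (show dOf c < 3 * (p : ℤ) from hd3)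
    omega
  -- the valuation of `ρ` (Legendre below `p²` on all 21 factorials) and the split of the pair floors
  have hval := padicValRat_rhoB_midParams hc hp hp2 hwin hdp
  have hpf := pairFloors_eq_eSum_add c p
  -- termwise facts on the six non-`E` floors (forms `< 2p` since `c₀ < 3p`)
  have hf1 : ∀ x ∈ nonE, pf c p x ≤ 1 := by
    intro x hx
    obtain ⟨hx1, hx2, hlt⟩ := nonE_bounds x hx
    obtain ⟨ha0, ha2⟩ := hnn x.1 hx1
    obtain ⟨hb0, hb2⟩ := hnn x.2 hx2
    have hform : c 0 - c (x.1 + 1) - c (x.2 + 1) < 2 * (p : ℤ) := by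
      by_cases h1 : x.1 = i
      · have := hblk x.2 hx2 (by omega); omega
      · have := hblk x.1 hx1 h1; omega
    have := (Int.ediv_lt_iff_lt_mul hp0).2 hform
    unfold pf; omega
  have hf0 : ∀ x ∈ nonE, ¬ (x.1 = i ∨ x.2 = i) → pf c p x = 0 := by
    intro x hx hxi
    rw [not_or] at hxi
    obtain ⟨hx1, hx2, hlt⟩ := nonE_bounds x hx
    have h1 := hblk x.1 hx1 hxi.1
    have h2 := hblk x.2 hx2 hxi.2
    obtain ⟨ha0, ha2⟩ := hnn x.1 hx1
    obtain ⟨hb0, hb2⟩ := hnn x.2 hx2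
    unfold pf
    exact Int.ediv_eq_zero_of_lt (by omega) (by omega)
  have hfp : ∀ x ∈ nonE, 1 ≤ pf c p x → (p : ℤ) ≤ c 0 - c (x.1 + 1) - c (x.2 + 1) := by
    intro x hx h1
    unfold pf at h1
    have := (Int.le_ediv_iff_mul_le hp0).1 h1
    linarith
  -- `A` := the non-`E` pairs charging a unit: at most two, all through the long slot, each a form `≥ p`
  set A := nonE.filter (fun x => 1 ≤ pf c p x) with hA
  have hAsub : A ⊆ nonE.filter (fun x => x.1 = i ∨ x.2 = i) := by
    intro x hx
    rw [hA, mem_filter] at hx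
    rw [mem_filter]
    refine ⟨hx.1, ?_⟩
    by_contra hxi
    have := hf0 x hx.1 hxi
    omega
  have hAcard : A.card ≤ 2 := (card_le_card hAsub).trans (card_nonE_filter_le hi7)
  have hsumA : nonESum c p ≤ (A.card : ℤ) := by
    have hsplit := Finset.sum_filter_add_sum_filter_not nonE (fun x => 1 ≤ pf c p x) (pf c p)
    unfold nonESum
    rw [← hsplit]
    have h1 := Finset.sum_le_card_nsmul (nonE.filter (fun x => 1 ≤ pf c p x)) (pf c p) 1
      fun x hx => hf1 x (mem_filter.1 hx).1
    have h2 : ∑ x ∈ nonE.filter (fun x => ¬ 1 ≤ pf c p x), pf c p x ≤ 0 :=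
      Finset.sum_nonpos fun x hx => by have := (mem_filter.1 hx).2; omega
    simp only [nsmul_eq_mul, mul_one] at h1
    rw [hA]
    linarith
  -- the denominator floors: each `⌊c_k/p⌋ ∈ {0,1}` (`c_k ≤ c₀/2 < 2p`), so `denSum ≤ nden ≤ nbig`
  have hterm : ∀ k, k < 7 → c (k + 1) / (p : ℤ) ≤ if (p : ℤ) ≤ c (k + 1) then 1 else 0 := by
    intro k hk
    obtain ⟨h0, h2⟩ := hnn k hk
    split_ifs with h
    · have := (Int.ediv_lt_iff_lt_mul hp0).2 (show c (k + 1) < 2 * (p : ℤ) by omega); omega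
    · rw [Int.ediv_eq_zero_of_lt h0 (not_le.1 h)]
  have hndenSum : (nden c p : ℤ) = ∑ k ∈ denSlots, (if (p : ℤ) ≤ c (k + 1) then (1 : ℤ) else 0) := by
    unfold nden; rw [natCast_card_filter]
  have hdenSlots : ∑ k ∈ denSlots, (if (p : ℤ) ≤ c (k + 1) then (1 : ℤ) else 0) =
      (if (p : ℤ) ≤ c 1 then (1 : ℤ) else 0) + (if (p : ℤ) ≤ c 4 then (1 : ℤ) else 0) +
        (if (p : ℤ) ≤ c 5 then (1 : ℤ) else 0) + (if (p : ℤ) ≤ c 6 then (1 : ℤ) else 0) +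
        (if (p : ℤ) ≤ c 7 then (1 : ℤ) else 0) := by
    simp only [denSlots]
    rw [Finset.sum_insert (by decide), Finset.sum_insert (by decide), Finset.sum_insert (by decide),
      Finset.sum_insert (by decide), Finset.sum_singleton]
    ring
  have hdexp : denSum c p = c 1 / p + c 4 / p + c 5 / p + c 6 / p + c 7 / p := by
    simp only [denSum, List.map_cons, List.map_nil, List.sum_cons, List.sum_nil]
    ring
  have hden : denSum c p ≤ (nden c p : ℤ) := by
    have h0 := hterm 0 (by norm_num)
    have h3 := hterm 3 (by norm_num)
    have h4 := hterm 4 (by norm_num)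
    have h5 := hterm 5 (by norm_num)
    have h6 := hterm 6 (by norm_num)
    simp only [Nat.reduceAdd] at h0 h3 h4 h5 h6
    rw [hdexp, hndenSum, hdenSlots]
    linarith
  have hndenB : (nden c p : ℤ) ≤ nbig c p := by
    have hBsum : (B.card : ℤ) = ∑ k ∈ range 7, (if (p : ℤ) ≤ c (k + 1) then (1 : ℤ) else 0) := by
      rw [hB, natCast_card_filter]
      exact Fin.sum_univ_eq_sum_range (fun k => if (p : ℤ) ≤ c (k + 1) then (1 : ℤ) else 0) 7
    have hsub : denSlots ⊆ range 7 := by decide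
    have hle := Finset.sum_le_sum_of_subset_of_nonneg hsub
      (f := fun k => if (p : ℤ) ≤ c (k + 1) then (1 : ℤ) else 0)
      (fun k _ _ => by positivity)
    rw [← hBn, hBsum, hndenSum]
    exact hle
  -- the sorted list of the 28 forms and the count of its entries `≥ p`
  set S := (forms28 c).insertionSort (· ≥ ·) with hS
  have hSsort : S.Pairwise (· ≥ ·) := List.pairwise_insertionSort _ _
  have hcountS : S.countP (fun y => decide ((p : ℤ) ≤ y)) =
      scheme.countP ((fun y => decide ((p : ℤ) ≤ y)) ∘ ev c) := by
    rw [hS, (List.perm_insertionSort (· ≥ ·) (forms28 c)).countP_eq, forms28_eq_scheme, List.countP_map]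
  have hmemS : ∀ x ∈ A, idxOf x ∈ scheme ∧ ((fun y => decide ((p : ℤ) ≤ y)) ∘ ev c) (idxOf x) = true := by
    intro x hx
    obtain ⟨hxn, hx1⟩ := mem_filter.1 hx
    refine ⟨idxOf_mem_scheme hxn, ?_⟩
    simp only [Function.comp_apply, ev_idxOf c x hxn, decide_eq_true_eq]
    exact hfp x hxn hx1
  have hmemB : ∀ k ∈ B, (Sum.inl k : Idx) ∈ scheme ∧ ((fun y => decide ((p : ℤ) ≤ y)) ∘ ev c) (Sum.inl k) = true := by
    intro k hk
    refine ⟨inl_mem_scheme k, ?_⟩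
    simp only [Function.comp_apply, ev_inl, decide_eq_true_eq]
    exact (mem_filter.1 hk).2
  -- the charged scheme entries `I = idxOf(A) ⊔ inl(B)`: `|A| + |B|` DISTINCT entries, each `≥ p`
  have hdisj : Disjoint (A.image idxOf) (B.image (Sum.inl : Fin 7 → Idx)) := by
    rw [Finset.disjoint_left]
    intro z hzA hzB
    obtain ⟨x, -, rfl⟩ := mem_image.1 hzA
    obtain ⟨k, -, hk⟩ := mem_image.1 hzB
    exact Sum.inl_ne_inr hk
  set I := (A.image idxOf).disjUnion (B.image (Sum.inl : Fin 7 → Idx)) hdisj with hI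
  have hIcard : I.card = A.card + B.card := by
    rw [hI, card_disjUnion, card_image_of_injective _ Sum.inl_injective, card_image_of_injOn]
    intro x hx y hy he
    exact idxOf_inj x (mem_filter.1 (mem_coe.1 hx)).1 y (mem_filter.1 (mem_coe.1 hy)).1 he
  have hmemI : ∀ z ∈ I, z ∈ scheme ∧ ((fun y => decide ((p : ℤ) ≤ y)) ∘ ev c) z = true := by
    intro z hz
    rcases mem_disjUnion.1 hz with hzA | hzB
    · obtain ⟨x, hx, rfl⟩ := mem_image.1 hzA; exact hmemS x hx
    · obtain ⟨k, hk, rfl⟩ := mem_image.1 hzB; exact hmemB k hk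
  have hcount : I.card ≤ S.countP (fun y => decide ((p : ℤ) ≤ y)) := by
    rw [hcountS]; exact card_le_countP scheme _ I hmemI
  -- payers: `T4 ≥ min(4,|I|)`; the flat fifth modulus pays one unit if `|I| ≥ 5` or `2p ≤ d`
  have hT4 : ((min 4 I.card : ℕ) : ℤ) ≤ T4 p S :=
    le_T4_of_countP hp1 hSsort (Nat.min_le_left _ _) ((Nat.min_le_right _ _).trans hcount)
  have hflat : eDflat c p = T4 p S + (Nat.log p (m5flat c).toNat : ℤ) := by
    rw [hS]; exact eDflat_eq_T4_add c p
  have hL5 : 0 ≤ (Nat.log p (m5flat c).toNat : ℤ) := Int.natCast_nonneg _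
  have hL5five : 5 ≤ I.card → 1 ≤ (Nat.log p (m5flat c).toNat : ℤ) := fun h5 =>
    one_le_log_of_le hp1 ((le_m5_of_countP c (h5.trans hcount)).trans (m5_le_m5flat c))
  have hL5two : 2 * (p : ℤ) ≤ dOf c → 1 ≤ (Nat.log p (m5flat c).toNat : ℤ) := fun h =>
    one_le_log_m5flat hp1 ((Int.le_ediv_iff_mul_le (by norm_num : (0 : ℤ) < 2)).2 (by linarith))
  -- the path budget under (DISJ)
  have hpath : (∀ j ∈ range 7, ∀ k ∈ range 7, j ≠ k → (p : ℤ) ≤ c (k + 1) → c 0 - c (j + 1) - c (k + 1) < p) →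
      (A.card : ℤ) + (nden c p : ℤ) ≤ 5 := by
    intro hdj
    set K := (range 7).filter (fun k => (p : ℤ) ≤ c (k + 1)) with hK
    have hends : ∀ x ∈ A, x.1 ∉ K ∧ x.2 ∉ K := by
      intro x hx
      obtain ⟨hxn, hx1⟩ := mem_filter.1 hx
      obtain ⟨hx17, hx27, hlt⟩ := nonE_bounds x hxn
      have hform := hfp x hxn hx1
      have hne : x.1 ≠ x.2 := by omega
      constructor
      · intro h1
        have hbig := (mem_filter.1 h1).2
        have := hdj x.2 (mem_range.2 hx27) x.1 (mem_range.2 hx17) (Ne.symm hne) hbig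
        linarith
      · intro h2
        have hbig := (mem_filter.1 h2).2
        have := hdj x.1 (mem_range.2 hx17) x.2 (mem_range.2 hx27) hne hbig
        linarith
    have hKpow : K ∈ (range 7).powerset := mem_powerset.2 (filter_subset _ _)
    have hApow : A ∈ (nonE.filter fun x : ℕ × ℕ => x.1 = i ∨ x.2 = i).powerset := mem_powerset.2 hAsub
    have hpb := path_budget i (mem_range.2 hi7) A hApow K hKpow hends
    have hKden : (denSlots.filter fun k => k ∈ K) = denSlots.filter (fun k => (p : ℤ) ≤ c (k + 1)) := by
      apply Finset.filter_congr
      intro k hk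
      have hk7 : k ∈ range 7 := (by decide : denSlots ⊆ range 7) hk
      rw [hK, mem_filter]
      exact ⟨fun h => h.2, fun h => ⟨hk7, h⟩⟩
    rw [hKden] at hpb
    unfold nden
    exact_mod_cast hpb
  have ha0 : (0 : ℤ) ≤ (A.card : ℤ) := Int.natCast_nonneg _
  have ha2 : (A.card : ℤ) ≤ 2 := by exact_mod_cast hAcard
  have hrefund : refund c p = min 1 (dOf c / (p : ℤ)) := rfl
  have hmin4 : min 4 ((A.card : ℤ) + nbig c p) ≤ T4 p S := by
    have h := hT4
    rw [hIcard, hBn] at h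
    rcases Nat.lt_or_ge 4 (A.card + nbig c p) with h4 | h4
    · rw [Nat.min_eq_left h4.le] at h
      have h4' : (4 : ℤ) ≤ (A.card : ℤ) + nbig c p := by exact_mod_cast h4.le
      rw [min_eq_left h4']
      exact_mod_cast h
    · rw [Nat.min_eq_right h4] at h
      rw [min_eq_right (by exact_mod_cast h4)]
      exact_mod_cast h
  have hfive : 5 ≤ (A.card : ℤ) + (nbig c p : ℤ) → 1 ≤ (Nat.log p (m5flat c).toNat : ℤ) := fun h5 =>
    hL5five (by rw [hIcard, hBn]; exact_mod_cast h5)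
  exact ⟨A.card, T4 p S, (Nat.log p (m5flat c).toNat : ℤ), ha0, ha2, hsumA, hden, hndenB, hmin4, hfive, hL5two, hL5,
    hflat, hval, hpf, hrefund, ht0, ht2, hpath⟩

end Cap

end Summit.KontsevichZagierPeriods.Zeta5Search.RVFlatGauge
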